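import Literature.NumberTheory.EllipticCurves.KubertTateSeven
import Literature.NumberTheory.EllipticCurves.Rank1Residual.X11RankOneCertificates.Minimality
import HarnessLib

/-!
# The integral Kubert–Tate model `E_{m,n}` is a GLOBAL MINIMAL MODEL (`m, n` coprime, `7 ∤ Δ`)

PROOF-ONLY file (theorems only), topic `NumberTheory/EllipticCurves`; sequel of `KubertTateSeven`
(`E_{m,n} = kubertTateSeven m n = [n² + mn − m², m²n(n−m), m²n³(n−m), 0, 0]`,
`Δ = m⁷n⁷(m−n)⁷·C`, `C = m³ − 8m²n + 5mn² + n³`, `c₄ = (m² − mn + n²)(m⁶ − 11m⁵n + … + n⁶)`).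

For COPRIME integers `m, n` a prime `q` dividing both `c₄(E_{m,n})` and `Δ(E_{m,n})` is `q = 7`
(`eq_seven_of_prime_dvd_c₄_of_dvd_Δ`): `c₄ ≡ n⁸ (mod m)`, `c₄ ≡ m⁸ (mod n)`, `c₄ ≡ n⁸ (mod m − n)`, and an
explicit Bézout identity `U·c₄ + V·C = 49·n¹⁰` in `ℤ[m,n]` (`bezout_c₄`). Hence in the TAME régime
`7 ∤ Δ` no prime has `q¹² ∣ Δ ∧ q⁴ ∣ c₄`, and Silverman's criterion (AEC VII.1 Rem. 1.1, tree
`isGloballyMinimal_of_int_criterion`) makes `E_{m,n}/ℚ` a global minimal model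
(**`isGloballyMinimal_kubertTateSeven`**) — so its reduction types, `a_p` and conductor exponents are read
off the integer equation itself (geometrically: a prime of additive reduction would carry the point
`(0,0)` of order `7` into `𝔾_a(𝔽_q)`, forcing `q = 7`).

The last section removes the tameness hypothesis: `C ≡ (m − 5n)³ (mod 7)` and `C(5n + 7k, n) =
49·(7(k²n + k³) − n³)`, so `7³ ∤ C(m,n)` for coprime `m, n` (`not_seven_pow_three_dvd_cube_form₇`), hence
`ord₇ Δ ≤ 2` in the wild case and **`isGloballyMinimal_kubertTateSeven_of_isCoprime`**: `E_{m,n}/ℚ` is a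
global minimal model for ALL coprime `m, n`.

## References

* [SilvermanAEC2009] J. H. Silverman, *AEC*, 2nd ed., III.1 (c₄, Δ), VII.1 Remark 1.1, VIII.8.
* [Kubert1976] D. S. Kubert, Proc. London Math. Soc. (3) 33 (1976), Table 3 (`N = 7`).
-/

set_option autoImplicit false

namespace WeierstrassCurve

open Literature.NumberTheory.EllipticCurves
open Literature.NumberTheory.EllipticCurves.Rank1Residual.X11RankOneCertificates

section Ring

variable {R : Type*} [CommRing R] (m n : R)

/-- `c₄(E_{m,n})` expanded: `m⁸ − 12m⁷n + 42m⁶n² − 56m⁵n³ + 35m⁴n⁴ − 14m²n⁶ + 4mn⁷ + n⁸`.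
[cite: SilvermanAEC2009, III.1 (c₄)] -/
theorem kubertTateSeven_c₄_expand :
    (kubertTateSeven m n).c₄ = m ^ 8 - 12 * m ^ 7 * n + 42 * m ^ 6 * n ^ 2 - 56 * m ^ 5 * n ^ 3
      + 35 * m ^ 4 * n ^ 4 - 14 * m ^ 2 * n ^ 6 + 4 * m * n ^ 7 + n ^ 8 := by
  rw [kubertTateSeven_c₄]; ring

/-- `c₄(E_{m,n}) ≡ n⁸ (mod m)`. [cite: SilvermanAEC2009, III.1 (c₄)] -/
theorem kubertTateSeven_c₄_eq_add_mul_left :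
    (kubertTateSeven m n).c₄ = n ^ 8 + m * (m ^ 7 - 12 * m ^ 6 * n + 42 * m ^ 5 * n ^ 2
      - 56 * m ^ 4 * n ^ 3 + 35 * m ^ 3 * n ^ 4 - 14 * m * n ^ 6 + 4 * n ^ 7) := by
  rw [kubertTateSeven_c₄]; ring

/-- `c₄(E_{m,n}) ≡ m⁸ (mod n)`. [cite: SilvermanAEC2009, III.1 (c₄)] -/
theorem kubertTateSeven_c₄_eq_add_mul_right :
    (kubertTateSeven m n).c₄ = m ^ 8 + n * (- 12 * m ^ 7 + 42 * m ^ 6 * n - 56 * m ^ 5 * n ^ 2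
      + 35 * m ^ 4 * n ^ 3 - 14 * m ^ 2 * n ^ 5 + 4 * m * n ^ 6 + n ^ 7) := by
  rw [kubertTateSeven_c₄]; ring

/-- `c₄(E_{m,n}) ≡ n⁸ (mod m − n)`. [cite: SilvermanAEC2009, III.1 (c₄)] -/
theorem kubertTateSeven_c₄_eq_add_mul_sub :
    (kubertTateSeven m n).c₄ = n ^ 8 + (m - n) * (m ^ 7 - 11 * m ^ 6 * n + 31 * m ^ 5 * n ^ 2
      - 25 * m ^ 4 * n ^ 3 + 10 * m ^ 3 * n ^ 4 + 10 * m ^ 2 * n ^ 5 - 4 * m * n ^ 6) := by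
  rw [kubertTateSeven_c₄]; ring

/-- **Bézout identity for `c₄` and the cubic factor `C = m³ − 8m²n + 5mn² + n³` of `Δ`**:
`U·c₄ + V·C = 49·n¹⁰` with explicit `U, V ∈ ℤ[m,n]` (the resultant of `c₄` and `C` is a power of `7`
times a power of `n`). [cite: SilvermanAEC2009, III.1 (c₄, Δ)] -/
theorem kubertTateSeven_bezout_c₄ :
    (- 444 * m ^ 2 + 3005 * m * n + 1710 * n ^ 2) * (kubertTateSeven m n).c₄
      + (444 * m ^ 7 - 4781 * m ^ 6 * n + 12530 * m ^ 5 * n ^ 2 - 6853 * m ^ 4 * n ^ 3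
          - 693 * m ^ 3 * n ^ 4 + 6776 * m ^ 2 * n ^ 5 - 1540 * m * n ^ 6 - 1661 * n ^ 7)
        * (m ^ 3 - 8 * m ^ 2 * n + 5 * m * n ^ 2 + n ^ 3) = 49 * n ^ 10 := by
  rw [kubertTateSeven_c₄]; ring

end Ring

section Int

variable (m n : ℤ)

/-- A prime dividing two coprime integers is absurd. [folklore] -/
private theorem not_prime_dvd_coprime {m n : ℤ} (hcop : IsCoprime m n) {q : ℕ} (hq : q.Prime)
    (hm : (q : ℤ) ∣ m) (hn : (q : ℤ) ∣ n) : False := by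
  have hu : IsUnit (q : ℤ) := hcop.isUnit_of_dvd' hm hn
  rw [Int.isUnit_iff] at hu
  have h2 : (2 : ℤ) ≤ q := by exact_mod_cast hq.two_le
  omega

/-- **For coprime `m, n`, a prime `q` with `q ∣ c₄(E_{m,n})` and `q ∣ Δ(E_{m,n})` is `q = 7`.**
(`Δ = (mn(m−n))⁷·C`; `c₄ ≡ n⁸, m⁸, n⁸` modulo `m, n, m − n`; `U c₄ + V C = 49 n¹⁰`.)
[cite: SilvermanAEC2009, III.1 and VII.1 Remark 1.1] -/
theorem eq_seven_of_prime_dvd_c₄_of_dvd_Δ (hcop : IsCoprime m n) {q : ℕ} (hq : q.Prime)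
    (h4 : (q : ℤ) ∣ (kubertTateSeven m n).c₄) (hΔ : (q : ℤ) ∣ (kubertTateSeven m n).Δ) : q = 7 := by
  have hp : Prime (q : ℤ) := Nat.prime_iff_prime_int.mp hq
  rw [kubertTateSeven_Δ] at hΔ
  -- `q ∣ m`, `q ∣ n`, `q ∣ m - n` or `q ∣ C`
  rcases hp.dvd_or_dvd hΔ with h123 | hC
  · rcases hp.dvd_or_dvd h123 with h12 | h3
    · rcases hp.dvd_or_dvd h12 with h1 | h2
      · -- `q ∣ m`: then `q ∣ n⁸`
        have hm : (q : ℤ) ∣ m := hp.dvd_of_dvd_pow h1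
        rw [kubertTateSeven_c₄_eq_add_mul_left] at h4
        have hn8 : (q : ℤ) ∣ n ^ 8 := (dvd_add_left (dvd_mul_of_dvd_left hm _)).mp h4
        exact (not_prime_dvd_coprime hcop hq hm (hp.dvd_of_dvd_pow hn8)).elim
      · -- `q ∣ n`: then `q ∣ m⁸`
        have hn : (q : ℤ) ∣ n := hp.dvd_of_dvd_pow h2
        rw [kubertTateSeven_c₄_eq_add_mul_right] at h4
        have hm8 : (q : ℤ) ∣ m ^ 8 := (dvd_add_left (dvd_mul_of_dvd_left hn _)).mp h4
        exact (not_prime_dvd_coprime hcop hq (hp.dvd_of_dvd_pow hm8) hn).elim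
    · -- `q ∣ m - n`: then `q ∣ n⁸`, so `q ∣ n` and `q ∣ m`
      have hmn : (q : ℤ) ∣ m - n := hp.dvd_of_dvd_pow h3
      rw [kubertTateSeven_c₄_eq_add_mul_sub] at h4
      have hn8 : (q : ℤ) ∣ n ^ 8 := (dvd_add_left (dvd_mul_of_dvd_left hmn _)).mp h4
      have hn : (q : ℤ) ∣ n := hp.dvd_of_dvd_pow hn8
      have hm : (q : ℤ) ∣ m := by
        have := dvd_add hmn hn
        rwa [sub_add_cancel] at this
      exact (not_prime_dvd_coprime hcop hq hm hn).elim
  · -- `q ∣ C`: Bézout gives `q ∣ 49 n¹⁰`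
    have hb := kubertTateSeven_bezout_c₄ m n
    have h49 : (q : ℤ) ∣ 49 * n ^ 10 := by
      rw [← hb]
      exact dvd_add (dvd_mul_of_dvd_right h4 _) (dvd_mul_of_dvd_right hC _)
    rcases hp.dvd_or_dvd h49 with h7 | hn10
    · have h77 : (q : ℤ) ∣ (7 : ℤ) ^ 2 := by norm_num; exact h7
      have h7' : (q : ℤ) ∣ 7 := hp.dvd_of_dvd_pow h77
      have h7n : q ∣ 7 := by exact_mod_cast h7'
      exact (Nat.prime_dvd_prime_iff_eq hq (by norm_num)).mp h7n
    · have hn : (q : ℤ) ∣ n := hp.dvd_of_dvd_pow hn10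
      -- `C = m³ + n(−8m² + 5mn + n²)`, so `q ∣ m³`
      have hC' : (q : ℤ) ∣ m ^ 3 + n * (-8 * m ^ 2 + 5 * m * n + n ^ 2) := by
        have e : m ^ 3 - 8 * m ^ 2 * n + 5 * m * n ^ 2 + n ^ 3 = m ^ 3 + n * (-8 * m ^ 2 + 5 * m * n + n ^ 2) := by
          ring
        rwa [e] at hC
      have hm3 : (q : ℤ) ∣ m ^ 3 := (dvd_add_left (dvd_mul_of_dvd_left hn _)).mp hC'
      exact (not_prime_dvd_coprime hcop hq (hp.dvd_of_dvd_pow hm3) hn).elim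

/-- The tree's list invariant `discOf` of the integer equation of `E_{m,n}` is `Δ(E_{m,n})`. [cite: SilvermanAEC2009, III.1] -/
theorem discOf_kubertTateSeven :
    discOf [n ^ 2 + m * n - m ^ 2, m ^ 2 * n * (n - m), m ^ 2 * n ^ 3 * (n - m), 0, 0] =
      (kubertTateSeven m n).Δ := by
  simp only [discOf, invariants, kubertTateSeven, Δ, b₂, b₄, b₆, b₈]
  ring

/-- The tree's list invariant `c4Of` of the integer equation of `E_{m,n}` is `c₄(E_{m,n})`. [cite: SilvermanAEC2009, III.1] -/
theorem c4Of_kubertTateSeven :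
    c4Of [n ^ 2 + m * n - m ^ 2, m ^ 2 * n * (n - m), m ^ 2 * n ^ 3 * (n - m), 0, 0] =
      (kubertTateSeven m n).c₄ := by
  simp only [c4Of, invariants, kubertTateSeven, c₄, b₂, b₄]
  ring

/-- `E_{m,n}/ℚ` is the literal rational equation with the integer coefficients of `E_{m,n}/ℤ`.
[cite: Kubert1976, Table 3 (N = 7)] -/
theorem kubertTateSeven_rat_eq_mk :
    kubertTateSeven (m : ℚ) (n : ℚ) =
      ⟨((n ^ 2 + m * n - m ^ 2 : ℤ) : ℚ), ((m ^ 2 * n * (n - m) : ℤ) : ℚ), ((m ^ 2 * n ^ 3 * (n - m) : ℤ) : ℚ),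
        ((0 : ℤ) : ℚ), ((0 : ℤ) : ℚ)⟩ := by
  ext <;> simp only [kubertTateSeven] <;> push_cast <;> ring

/-- `E_{m,n}/ℚ` is the base change of the integer equation `[n² + mn − m², m²n(n−m), m²n³(n−m), 0, 0]`.
[cite: Kubert1976, Table 3 (N = 7)] -/
theorem kubertTateSeven_rat_eq_map_mk :
    kubertTateSeven (m : ℚ) (n : ℚ) =
      (⟨n ^ 2 + m * n - m ^ 2, m ^ 2 * n * (n - m), m ^ 2 * n ^ 3 * (n - m), 0, 0⟩ : WeierstrassCurve ℤ).map
        (Int.castRingHom ℚ) := by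
  rw [kubertTateSeven_rat_eq_mk]
  ext <;> simp [map]

/-- The integer equation `[n² + mn − m², m²n(n−m), m²n³(n−m), 0, 0]` IS `kubertTateSeven m n` over `ℤ`.
[cite: Kubert1976, Table 3 (N = 7)] -/
theorem mk_eq_kubertTateSeven_int :
    (⟨n ^ 2 + m * n - m ^ 2, m ^ 2 * n * (n - m), m ^ 2 * n ^ 3 * (n - m), 0, 0⟩ : WeierstrassCurve ℤ) =
      kubertTateSeven m n := by
  ext <;> simp only [kubertTateSeven]

/-- **`E_{m,n}/ℚ` is a global minimal model for `m, n` coprime and `7 ∤ Δ(E_{m,n})`** (Silverman's criterion: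
no prime `q` with `q¹² ∣ Δ` and `q⁴ ∣ c₄`, since such a `q` divides `c₄` and `Δ`, hence is `7`).
[cite: SilvermanAEC2009, VII.1 Remark 1.1 and VIII.8] -/
theorem isGloballyMinimal_kubertTateSeven (hcop : IsCoprime m n) (h7 : ¬ (7 : ℤ) ∣ (kubertTateSeven m n).Δ) :
    (kubertTateSeven (m : ℚ) (n : ℚ)).IsGloballyMinimal := by
  have key := isGloballyMinimal_of_int_criterion (n ^ 2 + m * n - m ^ 2) (m ^ 2 * n * (n - m))
    (m ^ 2 * n ^ 3 * (n - m)) 0 0 fun q hq hdvd ↦ by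
      rw [discOf_kubertTateSeven, c4Of_kubertTateSeven] at hdvd
      obtain ⟨h12, h4⟩ := hdvd
      have hqΔ : (q : ℤ) ∣ (kubertTateSeven m n).Δ := (dvd_pow_self (q : ℤ) (by norm_num)).trans h12
      have hqc : (q : ℤ) ∣ (kubertTateSeven m n).c₄ := (dvd_pow_self (q : ℤ) (by norm_num)).trans h4
      have h := eq_seven_of_prime_dvd_c₄_of_dvd_Δ m n hcop hq hqc hqΔ
      subst h
      exact h7 (by exact_mod_cast hqΔ)
  rw [kubertTateSeven_rat_eq_mk]
  exact key

/-! ### The wild case `7 ∣ C`: `ord₇ C(m,n) = 2` exactly, so `E_{m,n}` is minimal at `7` too -/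

/-- `C = m³ − 8m²n + 5mn² + n³ ≡ (m − 5n)³ (mod 7)`: the cubic factor of `Δ(E_{m,n})` is a cube modulo `7`
(its splitting field `ℚ(ζ₇)⁺` is totally ramified at `7`). [cite: SilvermanAEC2009, III.1 (Δ)] -/
theorem cube_form₇_eq_cube_add_seven_mul (m n : ℤ) :
    m ^ 3 - 8 * m ^ 2 * n + 5 * m * n ^ 2 + n ^ 3 =
      (m - 5 * n) ^ 3 + 7 * (m ^ 2 * n - 10 * m * n ^ 2 + 18 * n ^ 3) := by
  ring

/-- On the residue class `m = 5n + 7k`: `C(5n + 7k, n) = 49·(7(k²n + k³) − n³)`. [cite: SilvermanAEC2009, III.1 (Δ)] -/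
theorem cube_form₇_five_mul_add (n k : ℤ) :
    (5 * n + 7 * k) ^ 3 - 8 * (5 * n + 7 * k) ^ 2 * n + 5 * (5 * n + 7 * k) * n ^ 2 + n ^ 3 =
      49 * (7 * (k ^ 2 * n + k ^ 3) - n ^ 3) := by
  ring

/-- **`7³ ∤ C(m,n)` for coprime `m, n`**: `7 ∣ C` forces `m ≡ 5n (mod 7)`, and then `C = 49·(7(…) − n³)` with
`7 ∤ n`. So `ord₇ Δ(E_{m,n}) ≤ 2` off the multiplicative classes `7 ∣ mn(m−n)`.
[cite: SilvermanAEC2009, VII.1 Remark 1.1] -/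
theorem not_seven_pow_three_dvd_cube_form₇ (hcop : IsCoprime m n) :
    ¬ (7 : ℤ) ^ 3 ∣ m ^ 3 - 8 * m ^ 2 * n + 5 * m * n ^ 2 + n ^ 3 := by
  have hp : Prime (7 : ℤ) := by norm_num
  intro h343
  have h7C : (7 : ℤ) ∣ m ^ 3 - 8 * m ^ 2 * n + 5 * m * n ^ 2 + n ^ 3 := (dvd_pow_self 7 (by norm_num)).trans h343
  -- `7 ∣ (m - 5n)³`, so `7 ∣ m - 5n`
  rw [cube_form₇_eq_cube_add_seven_mul] at h7C
  have h75 : (7 : ℤ) ∣ (m - 5 * n) ^ 3 := (dvd_add_left (dvd_mul_right 7 _)).mp h7C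
  obtain ⟨k, hk⟩ := hp.dvd_of_dvd_pow h75
  have hm : m = 5 * n + 7 * k := by linear_combination hk
  subst hm
  rw [cube_form₇_five_mul_add] at h343
  -- `343 ∣ 49 u` gives `7 ∣ u = 7(…) − n³`, so `7 ∣ n³`
  have h7u : (7 : ℤ) ∣ 7 * (k ^ 2 * n + k ^ 3) - n ^ 3 := by
    have e : (7 : ℤ) ^ 3 = 49 * 7 := by norm_num
    rw [e] at h343
    exact (mul_dvd_mul_iff_left (by norm_num : (49 : ℤ) ≠ 0)).mp h343
  have hn3 : (7 : ℤ) ∣ n ^ 3 := (dvd_sub_right (dvd_mul_right 7 _)).mp h7u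
  have hn : (7 : ℤ) ∣ n := hp.dvd_of_dvd_pow hn3
  have hm : (7 : ℤ) ∣ 5 * n + 7 * k := dvd_add (dvd_mul_of_dvd_right hn 5) (dvd_mul_right 7 k)
  exact not_prime_dvd_coprime hcop (q := 7) (by norm_num) (by exact_mod_cast hm) (by exact_mod_cast hn)

/-- **No prime `q` has `q¹² ∣ Δ(E_{m,n})` and `q⁴ ∣ c₄(E_{m,n})` when `m, n` are coprime** — with NO
tameness hypothesis: such a `q` is `7` with `7 ∤ mn(m−n)` (else `c₄` is a `7`-unit), whence `7¹² ∣ C`,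
contradicting `7³ ∤ C`. [cite: SilvermanAEC2009, VII.1 Remark 1.1] -/
theorem not_pow_dvd_Δ_and_pow_dvd_c₄ (hcop : IsCoprime m n) {q : ℕ} (hq : q.Prime) :
    ¬ ((q : ℤ) ^ 12 ∣ (kubertTateSeven m n).Δ ∧ (q : ℤ) ^ 4 ∣ (kubertTateSeven m n).c₄) := by
  rintro ⟨h12, h4⟩
  have hqΔ : (q : ℤ) ∣ (kubertTateSeven m n).Δ := (dvd_pow_self (q : ℤ) (by norm_num)).trans h12
  have hqc : (q : ℤ) ∣ (kubertTateSeven m n).c₄ := (dvd_pow_self (q : ℤ) (by norm_num)).trans h4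
  have h := eq_seven_of_prime_dvd_c₄_of_dvd_Δ m n hcop hq hqc hqΔ
  subst h
  have hp : Prime ((7 : ℕ) : ℤ) := Nat.prime_iff_prime_int.mp hq
  -- `7 ∤ m`, `7 ∤ n`, `7 ∤ m - n` (else `c₄` would be a unit mod `7`, as in the tame argument)
  have hm : ¬ ((7 : ℕ) : ℤ) ∣ m := fun hm ↦ by
    rw [kubertTateSeven_c₄_eq_add_mul_left] at hqc
    have hn8 : ((7 : ℕ) : ℤ) ∣ n ^ 8 := (dvd_add_left (dvd_mul_of_dvd_left hm _)).mp hqc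
    exact not_prime_dvd_coprime hcop hq hm (hp.dvd_of_dvd_pow hn8)
  have hn : ¬ ((7 : ℕ) : ℤ) ∣ n := fun hn ↦ by
    rw [kubertTateSeven_c₄_eq_add_mul_right] at hqc
    have hm8 : ((7 : ℕ) : ℤ) ∣ m ^ 8 := (dvd_add_left (dvd_mul_of_dvd_left hn _)).mp hqc
    exact not_prime_dvd_coprime hcop hq (hp.dvd_of_dvd_pow hm8) hn
  have hmn : ¬ ((7 : ℕ) : ℤ) ∣ m - n := fun hmn ↦ by
    rw [kubertTateSeven_c₄_eq_add_mul_sub] at hqc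
    have hn8 : ((7 : ℕ) : ℤ) ∣ n ^ 8 := (dvd_add_left (dvd_mul_of_dvd_left hmn _)).mp hqc
    have hn' : ((7 : ℕ) : ℤ) ∣ n := hp.dvd_of_dvd_pow hn8
    have hm' : ((7 : ℕ) : ℤ) ∣ m := by
      have := dvd_add hmn hn'
      rwa [sub_add_cancel] at this
    exact not_prime_dvd_coprime hcop hq hm' hn'
  -- strip the unit factors `m⁷ n⁷ (m-n)⁷` from `7¹² ∣ Δ`
  rw [kubertTateSeven_Δ] at h12
  have h1 : ¬ ((7 : ℕ) : ℤ) ∣ m ^ 7 := fun h ↦ hm (hp.dvd_of_dvd_pow h)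
  have h2 : ¬ ((7 : ℕ) : ℤ) ∣ n ^ 7 := fun h ↦ hn (hp.dvd_of_dvd_pow h)
  have h3 : ¬ ((7 : ℕ) : ℤ) ∣ (m - n) ^ 7 := fun h ↦ hmn (hp.dvd_of_dvd_pow h)
  have h123 : ¬ ((7 : ℕ) : ℤ) ∣ m ^ 7 * n ^ 7 * (m - n) ^ 7 := by
    intro h
    rcases hp.dvd_or_dvd h with h' | h'
    · rcases hp.dvd_or_dvd h' with h'' | h''
      · exact h1 h''
      · exact h2 h''
    · exact h3 h'
  have hC12 : ((7 : ℕ) : ℤ) ^ 12 ∣ m ^ 3 - 8 * m ^ 2 * n + 5 * m * n ^ 2 + n ^ 3 :=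
    hp.pow_dvd_of_dvd_mul_left 12 h123 h12
  have hC3 : (7 : ℤ) ^ 3 ∣ m ^ 3 - 8 * m ^ 2 * n + 5 * m * n ^ 2 + n ^ 3 :=
    (pow_dvd_pow (7 : ℤ) (by norm_num : 3 ≤ 12)).trans (by exact_mod_cast hC12)
  exact not_seven_pow_three_dvd_cube_form₇ m n hcop hC3

/-- **`E_{m,n}/ℚ` is a global minimal model for ALL coprime `m, n`** (Tate normal form with a point of order
`7`: multiplicative at the primes of `mn(m−n)`, `ord₇ Δ = 2` in the wild case `7 ∣ C`, good elsewhere off `C`;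
Silverman's criterion at every prime). [cite: SilvermanAEC2009, VII.1 Remark 1.1 and VIII.8] -/
theorem isGloballyMinimal_kubertTateSeven_of_isCoprime (hcop : IsCoprime m n) :
    (kubertTateSeven (m : ℚ) (n : ℚ)).IsGloballyMinimal := by
  have key := isGloballyMinimal_of_int_criterion (n ^ 2 + m * n - m ^ 2) (m ^ 2 * n * (n - m))
    (m ^ 2 * n ^ 3 * (n - m)) 0 0 fun q hq hdvd ↦ by
      rw [discOf_kubertTateSeven, c4Of_kubertTateSeven] at hdvd
      exact not_pow_dvd_Δ_and_pow_dvd_c₄ m n hcop hq hdvd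
  rw [kubertTateSeven_rat_eq_mk]
  exact key

end Int

end WeierstrassCurve
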